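/-
Copyright (c) 2026 the pub-hodgecm-mathlib formalisation cell (harness21).  Prover seat hodgecm-mathlib-R90-C131-p04 (g3), Track B ∕ R90-TF, h413 = `stmt-HodgeConjecture-24833`,
R90-TF section S8 «ContSpec-n½» (S8 dealer R90-CS-plan (g4) S8-R298 (2) «W13 = (V♭) FRAME PACK»; typ2 (g4) FRAME LEDGER `R90/S8/PROBE-binders-vs-sockets.typ2-g4.md` §2 ∕ §2′):
the (V♭) OF RECORD un-τ head ★ p865404 `resGMidBlock_eq_bot_of_not_lHalfNeZero_of_record_v3` RE-EXPORTED in the socket's frame with its FREE frame binders, its ★-glue rows and its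
`hEXP` row DISCHARGED in-file.
-/
import Summits.HodgeConjecture.HodgeConjecture.Theorems.R90S8ResGMidBlockEqBotOfRecordV3U3             -- ★ p865404 (K2E1-p13 (g6)): (V♭) OF RECORD ED. 3 `resGMidBlock_eq_bot_of_not_lHalfNeZero_of_record_v3` (hW1 := ★ p865346 `hW1_of_locallyBoundedContinuation`)
import Summits.HodgeConjecture.HodgeConjecture.Theorems.R90S8ResGMidBlockNeBotAssemblyU3              -- ★ (K2E1): §1 `isUnitary_bcηInv_mul`, `bcηInv_mul_posRealIdele`, `bcηInv_mul_ne_one` (the ★-glue rows from the socket's `hμu hquad`); brings ★ `exists_structural_datum_cm_three`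
import Summits.HodgeConjecture.HodgeConjecture.Theorems.R90S8KTypeCoweightLineProductU3               -- ★ p864934 (K2E2-p12): §3 `hEXP_tauRow_of_record` (the `hEXP` row from `hμu` and the frame ALONE: ★ `hEXP_tauRow_closed'` ∘ ★ `hCO_of_transposeRealisations`)
import Summits.HodgeConjecture.HodgeConjecture.Theorems.K2E1SphericalEisensteinStructuralDataCMThree   -- ★ (K2E1): `exists_haar_coveringWeight_unfoldedMeasure_cm_three` (the `νG β μZ` cluster)
import Literature.NumberTheory.GaloisRepresentations.HeckeCharacterRamificationProofs                  -- ★ `HeckeCharacter.finite_ramifiedPlaces_holds` (Tate, Lemma 3.2.1: `χ.ramifiedPlaces` is finite)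
import Literature.NumberTheory.Automorphic.UnitaryGroupArchUnimodular                                  -- ★ `modularCharacterFun_arch_eq_one` (`G_∞` unimodular at the antidiagonal form)
import Literature.NumberTheory.Automorphic.UnitaryGroupAdelicProductHaar                               -- ★ `locallyCompactSpace_finAdelic`
import HarnessLib

/-!
# S8 socket (V♭) :406 — `R90S8ResGMidBlockEqBotOfRecordFramedU3`: (V♭) OF RECORD ED. 3, FRAMED — `¬ L(½, φ_ξ) ≠ 0 ⟹ resGMidBlock ξ μω = ⊥` from the socket frame and the letters only

Track B ∕ R90-TF, crux h413 = `stmt-HodgeConjecture-24833`, route of record `HCCMUnconditional`; cell `hodgecm-mathlib`, R90-TF section S8 «ContSpec-n½», socket (V♭)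
`sock_S8_res_midBlock_eq_bot_of_not_lHalfNeZero` (B ED. 7 :406: `∀ L … μ [aut] μω (hμu) (hquad) ξ, ¬ LHalfNeZero (ξ.bcη⁻¹ * μω) → resGMidBlock L μ ξ μω = ⊥`).  THEOREMS ONLY
(no `def`, no `instance`, no `notation`, no named-fact hypothesis, no `sorry`; default heartbeats); lane `--supports stmt-HodgeConjecture-24833 --as helper` (count-neutral).
CLOSES NO SOCKET and PAYS NO LETTER: it shortens the binder telescope of the (V♭) OF RECORD head (★ p865404, ED. 3) to «socket frame + riders + letters»; (V♭) stays ★ OF RECORD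
modulo {(hLB) J-S8-hW1′, (R)′'s conclusion `hR` at a Borel datum `𝔓 h𝔓`, (R)′τ's `hSCALrows` row}.

THE FRAME PACK (typ2 (g4) PROBE §2 ∕ §2′ applied to ED. 3's un-τ head, 33 binders).  DISCHARGED INSIDE: (G) the three ★-glue rows `hφu hφA hφ1` (★ `isUnitary_bcηInv_mul L ξ hμu`,
★ `bcηInv_mul_posRealIdele L ξ μω hquad`, ★ `bcηInv_mul_ne_one L ξ μω hquad` — this is where the socket's `hμu hquad` are consumed); (W-data) the ramification sets BOUND BY NAME as in
(V) OF RECORD since ED. 9: `S := (ξ.bcη⁻¹ * μω).ramifiedPlaces` (finite: ★ `HeckeCharacter.finite_ramifiedPlaces_holds`, Tate Lemma 3.2.1; `hurφ` by definition of `ramifiedPlaces`),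
`T := ∅` (`hurη` ★ `HeckeCharacter.isUnramifiedAt_one`); (F) the NORMALISED Heisenberg package `ν₀ [IsHaar] [IsInvInvariant] 𝓕₀ h𝓕₀ h𝓕₀c h𝓕₀1` (ONE `obtain` from ★
`exists_structural_datum_cm_three L`; FREE in ED. 3 because `hSCALrows` quantifies its own `ν 𝓕`); (L→★) the `hEXP` row (★ p864934 §3 `hEXP_tauRow_of_record L μ νG ν h𝓕N h𝓕c h𝓕₀
hβ hμZ μa μf ξ μω hμu`, letter-free: ★ `hEXP_tauRow_closed'` with `hCO′ :=` ★ `hCO_of_transposeRealisations`), whose own frame is discharged as in ★ W0 ∕ ★ W12: the σ-algebras of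
`G_∞`, `G_f` and the ideles (`borel _`, `⟨rfl⟩`), the `G`-side cluster `νG β μZ` (★ `exists_haar_coveringWeight_unfoldedMeasure_cm_three L`), the same Heisenberg `ν` (right-invariant:
Haar + inversion-invariant, Mathlib `Measure.inv.instIsMulRightInvariant` ∘ `Measure.inv_eq_self`), the port Haar measures `μa` (unimodular by ★
`isMulRightInvariant_of_modularCharacterFun_eq_one` ∘ ★ `modularCharacterFun_arch_eq_one` [Rogawski1990 §14.2]) and `μf` (★ `locallyCompactSpace_finAdelic`) — Mathlib `Measure.haar`.
What RIDES: the σ-algebra of `G(𝔸)` (in the cone of `hSCALrows`: its clause `Measurable fun g => Ag g (3∕2)`); the letter (hLB) (J-S8-hW1′, ★ p865346's hypothesis, bytes of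
ED. 3 :185–194); the Borel parabolic datum `𝔓 h𝔓` with (R)′'s LITERAL conclusion `hR : resGMidBlock L μ ξ μω ≤ L²_res(𝔓)` (socket (R)′ :337's body); (R)′τ's `hSCALrows` ROW in
ED. 3's bytes (:221–238) READ AT `S := (ξ.bcη⁻¹ * μω).ramifiedPlaces`, `T := ∅` (the (V) OF RECORD reading of `hunfK`, ★ p865286).
* **`resGMidBlock_eq_bot_of_not_lHalfNeZero_of_record_framed`** — ED. 3's conclusion `¬ LHalfNeZero (ξ.bcη⁻¹ * μω) → resGMidBlock L μ ξ μω = ⊥` from the riding binders only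
  (33 → 17 binders: frame 10 = `L` + 3 insts + 2 σ-algebra riders + `μ [aut] μω ξ` · socket hypotheses `hμu hquad` 2 · `hLB` 1 · `𝔓 h𝔓 hR` 3 · `hSCALrows` 1).
HONEST LABEL: HC_CM is proved only modulo the 7 printed citations (2 remaining named inputs: hLiu418 = `stmt-HodgeConjecture-24832`, h413 = `stmt-HodgeConjecture-24833`) until
rung 0 closes; REL ≠ ★ ≠ BUILT; frame plumbing, no letter paid, no socket closed; count-neutral.

## References
* [Rogawski1990] J. D. Rogawski, *Automorphic Representations of Unitary Groups in Three Variables* (1990), §13.9 (ii) p. 229, §14.2 p. 232.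
* [MoeglinWaldspurger1995] C. Mœglin, J.-L. Waldspurger, *Spectral Decomposition and Eisenstein Series* (1995), IV.1.9–IV.1.11, V.3.13.
* [TateThesis1967] J. Tate, *Fourier analysis in number fields and Hecke's zeta-functions* (1950∕1967), Lemma 3.2.1.
* [WeilIntegration1965] A. Weil, *L'intégration dans les groupes topologiques et ses applications* (2ᵉ éd., 1965), §9.
-/

set_option autoImplicit false
set_option linter.dupNamespace false  -- the mandated namespace `…HodgeConjecture.HodgeConjecture.R90.S8` (LEAD #1 L1) repeats the summit's segment

noncomputable section

open MeasureTheory Measure Set Filter Topology NumberField IsDedekindDomain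
open scoped ENNReal NNReal Topology
open Literature.MeasureTheory.Group Literature.NumberTheory
open Literature.NumberTheory.Automorphic Literature.NumberTheory.Automorphic.UnitaryGroup Literature.NumberTheory.GaloisRepresentations Literature.NumberTheory.LFunctions AdelicGroupData ContRepresentation
open Literature.NumberTheory.Automorphic.Arthur2013.Leaves.TECR Literature.NumberTheory.Rogawski1990
open Summit.HodgeConjecture.HodgeConjecture.Cruxes.H413.K2E1BorelEisensteinU
open Summit.HodgeConjecture.HodgeConjecture.Cruxes.H413.K2E1BLBorelSpacesU2Defs Summit.HodgeConjecture.HodgeConjecture.Cruxes.H413.K2E1BLBorelOperatorsU2Defs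
open Summit.HodgeConjecture.HodgeConjecture.Cruxes.H413.K2E1CharacterEisensteinU3PairDefs
open Summit.HodgeConjecture.HodgeConjecture.Cruxes.H413.K2E1ChiSectionSpaceU3PairDefs
open Summit.HodgeConjecture.HodgeConjecture.Cruxes.H413.K2E1CuspidalSpectrumUnitary
open Summit.HodgeConjecture.HodgeConjecture.Cruxes.H413.K2E1HeckeLHalfNeZeroDefs (LHalfNeZero)
open Summit.HodgeConjecture.HodgeConjecture.Cruxes.H413.K2E1SphericalEisensteinStructuralDataCMThree (exists_haar_coveringWeight_unfoldedMeasure_cm_three)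
open Summit.HodgeConjecture.HodgeConjecture.Cruxes.H413.K2E1MaassSelbergCMThreeFinal (exists_structural_datum_cm_three)

namespace Summit.HodgeConjecture.HodgeConjecture.R90.S8

variable (L : Type) [Field L] [NumberField L] [IsCMField L]
  [MeasurableSpace (quasiSplit (↥(maximalRealSubfield L)) L (IsCMField.complexConj L) 3).Adelic] [BorelSpace (quasiSplit (↥(maximalRealSubfield L)) L (IsCMField.complexConj L) 3).Adelic]

/-- **(V♭) OF RECORD, ED. 3 FRAMED — `¬ LHalfNeZero (ξ.bcη⁻¹·μω) → resGMidBlock L μ ξ μω = ⊥`** from the RIDING binders only: B's frame `L μ μω hμu hquad ξ`; the letter (hLB)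
(J-S8-hW1′: local boundedness on compacta of the continuation of every continuous pair-section's Eisenstein series, ★ p865346's hypothesis); a Borel parabolic datum `𝔓 h𝔓` with
(R)′'s literal conclusion `hR`; (R)′τ's `hSCALrows` row (ED. 3's bytes) read at `S := (ξ.bcη⁻¹ * μω).ramifiedPlaces`, `T := ∅`.  Discharged inside (module doc): the ★-glue rows
`hφu hφA hφ1` from `hμu hquad`, the ramification data, the normalised Heisenberg package, and the `hEXP` row with its whole Haar frame. [cite: Rogawski1990, §13.9 (ii) p. 229]
[cite: MoeglinWaldspurger1995, IV.1.11, V.3.13] [cite: TateThesis1967, Lemma 3.2.1] [cite: WeilIntegration1965, §9] -/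
theorem resGMidBlock_eq_bot_of_not_lHalfNeZero_of_record_framed
    (μ : Measure (quasiSplit (↥(maximalRealSubfield L)) L (IsCMField.complexConj L) 3).automorphicQuotient) [(quasiSplit (↥(maximalRealSubfield L)) L (IsCMField.complexConj L) 3).IsAutomorphicMeasure μ]
    (μω : HeckeCharacter L) (hμu : μω.IsUnitary)
    (hquad : ∀ x : Literature.NumberTheory.GaloisRepresentations.ideleGroup ↥(maximalRealSubfield L), μω (AdeleRing.ideleBaseChange (↥(maximalRealSubfield L)) L x) = quadraticHeckeCharCM L x)
    (ξ : OneDimAutRepH L)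
    -- J-S8-hW1′: the ONE letter (hLB) of ★ p865346 `hW1_of_locallyBoundedContinuation` (ED. 3 :185–194, byte for byte)
    (hLB : ∀ (φ : (quasiSplit (↥(maximalRealSubfield L)) L (IsCMField.complexConj L) 3).Adelic → ℂ)
      (_ : φ ∈ chiSectionSpacePair (ξ.bcη⁻¹ * ξ.bcψ⁻¹ * μω) ξ.ψ (⊥ : Subgroup (quasiSplit (↥(maximalRealSubfield L)) L (IsCMField.complexConj L) 3).Adelic)
        ((1 : ↥(⊥ : Subgroup (quasiSplit (↥(maximalRealSubfield L)) L (IsCMField.complexConj L) 3).Adelic) →* ℂ) :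
          ↥(⊥ : Subgroup (quasiSplit (↥(maximalRealSubfield L)) L (IsCMField.complexConj L) 3).Adelic) → ℂ)) (_ : Continuous φ)
      (Ec : ℂ → (quasiSplit (↥(maximalRealSubfield L)) L (IsCMField.complexConj L) 3).Adelic → ℂ) (Sp : Finset ℂ)
      (_ : ∀ s ∈ Sp, s.im = 0 ∧ 1 < s.re ∧ s.re ≤ 2)
      (_ : ∀ g, DifferentiableOn ℂ (fun z => Ec z g) ({z : ℂ | 1 < z.re} \ (↑Sp : Set ℂ)))
      (_ : ∀ z : ℂ, 2 < z.re → Ec z = eisensteinSeriesU (flatSectionU φ z)),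
      ∀ z₁ ∈ ({z : ℂ | 1 < z.re} \ (↑Sp : Set ℂ)), ∀ S : Set (quasiSplit (↥(maximalRealSubfield L)) L (IsCMField.complexConj L) 3).Adelic, IsCompact S →
        ∃ V ∈ 𝓝 z₁, ∃ M : ℝ, ∀ z ∈ V, ∀ g ∈ S, ‖Ec z g‖ ≤ M)
    -- a Borel parabolic datum and (R)′'s LITERAL conclusion at it (socket (R)′ :337's body)
    (𝔓 : (quasiSplit (↥(maximalRealSubfield L)) L (IsCMField.complexConj L) 3).ParabolicUnipotentData)
    (h𝔓 : ∀ j : 𝔓.ι, 𝔓.radical j = adelicUnipotent (↥(maximalRealSubfield L)) L (IsCMField.complexConj L) 3)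
    -- (R)′τ's literal conclusion
    (hR : resGMidBlock L μ ξ μω ≤ residualSubspace (quasiSplit (↥(maximalRealSubfield L)) L (IsCMField.complexConj L) 3) μ 𝔓)
    -- (R)′τ's `hSCALrows` ROW, BYTE FOR BYTE (★ `res_midBlock_le_residual_of_tauAdmissible` :110–125) at `cS :=` the block's explicit scalar `L^S(z−1)ζ^T(2z−2)∕(L^S(z)ζ^T(2z−1))`
    (hSCALrows : ∀ (U₀ : Subgroup ↥(finAdelic (↥(maximalRealSubfield L)) L (IsCMField.complexConj L) 3 ((StdForm.antidiagonal 3).over L))) (_ : IsTauLevel L U₀)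
      (φ : (quasiSplit (↥(maximalRealSubfield L)) L (IsCMField.complexConj L) 3).Adelic → ℂ) (_ : φ ∈ chiSectionSpacePair (ξ.bcη⁻¹ * ξ.bcψ⁻¹ * μω) ξ.ψ (tauLevel L U₀) ((1 : ↥(tauLevel L U₀) →* ℂ) : ↥(tauLevel L U₀) → ℂ)) (_ : Continuous φ)
      (_ : IsArchFinite L φ)
      (Ec : ℂ → (quasiSplit (↥(maximalRealSubfield L)) L (IsCMField.complexConj L) 3).Adelic → ℂ) (Sp : Finset ℂ) (_ : ∀ s ∈ Sp, s.im = 0 ∧ 1 < s.re ∧ s.re ≤ 2)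
      (_ : ∀ g, DifferentiableOn ℂ (fun z => Ec z g) ({z : ℂ | 1 < z.re} \ (↑Sp : Set ℂ)))
      (_ : ∀ z : ℂ, 2 < z.re → Ec z = eisensteinSeriesU (flatSectionU φ z))
      (Fp : (quasiSplit (↥(maximalRealSubfield L)) L (IsCMField.complexConj L) 3).Adelic → ℂ → ℂ) (_ : ∀ g, AnalyticAt ℂ (Fp g) ((3 : ℂ) / 2))
      (_ : ∀ g, Fp g =ᶠ[𝓝[≠] ((3 : ℂ) / 2)] fun z => (z - (3 : ℂ) / 2) * Ec z g)
      (f : (quasiSplit (↥(maximalRealSubfield L)) L (IsCMField.complexConj L) 3).L2 μ) (_ : (f : (quasiSplit (↥(maximalRealSubfield L)) L (IsCMField.complexConj L) 3).automorphicQuotient → ℂ) =ᵐ[μ] fun x => Fp (Quotient.out (x : (quasiSplit (↥(maximalRealSubfield L)) L (IsCMField.complexConj L) 3).Adelic ⧸ (quasiSplit (↥(maximalRealSubfield L)) L (IsCMField.complexConj L) 3).quotientSubgroup))⁻¹ ((3 : ℂ) / 2))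
      (ν : Measure ↥(adelicUnipotent (↥(maximalRealSubfield L)) L (IsCMField.complexConj L) 3)) (_ : ν.IsHaarMeasure) (𝓕 : Set ↥(adelicUnipotent (↥(maximalRealSubfield L)) L (IsCMField.complexConj L) 3)) (_ : IsFundamentalDomain ↥(rationalUnipotent (↥(maximalRealSubfield L)) L (IsCMField.complexConj L) 3) 𝓕 ν) (_ : IsCompact (closure 𝓕)) (_ : ν.IsInvInvariant) (_ : ν 𝓕 = 1),
      ∃ (Ag : (quasiSplit (↥(maximalRealSubfield L)) L (IsCMField.complexConj L) 3).Adelic → ℂ → ℂ) (M : ℝ),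
        (∀ g, DifferentiableOn ℂ (Ag g) {z : ℂ | 1 < z.re}) ∧ (∀ g, ‖Ag g (3 / 2)‖ ≤ M) ∧
        (∀ z : ℂ, 2 < z.re → ∀ g : (quasiSplit (↥(maximalRealSubfield L)) L (IsCMField.complexConj L) 3).Adelic, (borelConstantTerm ν 𝓕 (Ec z) g - φ g * (((borelHeight g : ℝ≥0) : ℝ) : ℂ) ^ z) / (((borelHeight g : ℝ≥0) : ℝ) : ℂ) ^ (2 - z) = Ag g z *
          ((partialStandardL (ξ.bcη⁻¹ * μω).ramifiedPlaces (fun w => {(ξ.bcη⁻¹ * μω).valueAtUniformizer w}) (z - 1) * partialStandardL (∅ : Set (HeightOneSpectrum (𝓞 ↥(maximalRealSubfield L)))) (fun v => {(1 : HeckeCharacter ↥(maximalRealSubfield L)).valueAtUniformizer v}) (2 * z - 2)) /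
            (partialStandardL (ξ.bcη⁻¹ * μω).ramifiedPlaces (fun w => {(ξ.bcη⁻¹ * μω).valueAtUniformizer w}) z * partialStandardL (∅ : Set (HeightOneSpectrum (𝓞 ↥(maximalRealSubfield L)))) (fun v => {(1 : HeckeCharacter ↥(maximalRealSubfield L)).valueAtUniformizer v}) (2 * z - 1)))) ∧
        (Measurable fun g : (quasiSplit (↥(maximalRealSubfield L)) L (IsCMField.complexConj L) 3).Adelic => Ag g ((3 : ℂ) / 2)) ∧
        (∀ b ∈ arithmeticBorel (↥(maximalRealSubfield L)) L (IsCMField.complexConj L) 3, ∀ x : (quasiSplit (↥(maximalRealSubfield L)) L (IsCMField.complexConj L) 3).Adelic, Ag ((b : (quasiSplit (↥(maximalRealSubfield L)) L (IsCMField.complexConj L) 3).Adelic) * x) ((3 : ℂ) / 2) = Ag x ((3 : ℂ) / 2)) ∧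
        (∀ (u : ↥(adelicUnipotent (↥(maximalRealSubfield L)) L (IsCMField.complexConj L) 3)) (g : (quasiSplit (↥(maximalRealSubfield L)) L (IsCMField.complexConj L) 3).Adelic), Ag ((u : (quasiSplit (↥(maximalRealSubfield L)) L (IsCMField.complexConj L) 3).Adelic) * g) ((3 : ℂ) / 2) = Ag g ((3 : ℂ) / 2))) :
    ¬ LHalfNeZero (ξ.bcη⁻¹ * μω) → resGMidBlock L μ ξ μω = ⊥ := by
  -- F1′: Borel σ-algebras on `G_∞`, `G_f` and the ideles
  letI : MeasurableSpace ↥(arch (↥(maximalRealSubfield L)) L (IsCMField.complexConj L) 3 ((StdForm.antidiagonal 3).over L)) := borel _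
  haveI : BorelSpace ↥(arch (↥(maximalRealSubfield L)) L (IsCMField.complexConj L) 3 ((StdForm.antidiagonal 3).over L)) := ⟨rfl⟩
  letI : MeasurableSpace ↥(finAdelic (↥(maximalRealSubfield L)) L (IsCMField.complexConj L) 3 ((StdForm.antidiagonal 3).over L)) := borel _
  haveI : BorelSpace ↥(finAdelic (↥(maximalRealSubfield L)) L (IsCMField.complexConj L) 3 ((StdForm.antidiagonal 3).over L)) := ⟨rfl⟩
  letI : MeasurableSpace (AdeleRing (𝓞 L) L)ˣ := borel _
  haveI : BorelSpace (AdeleRing (𝓞 L) L)ˣ := ⟨rfl⟩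
  -- F3: the `G`-side structural cluster `νG β μZ` (★ one-shot package)
  obtain ⟨νG, β, μZ, hH, -, hI, hS', hβ, hSZ, hμZ⟩ := exists_haar_coveringWeight_unfoldedMeasure_cm_three L
  haveI := hH
  haveI := hI
  haveI := hS'
  haveI := hSZ
  -- F4: the NORMALISED Heisenberg package `(ν, 𝓕)`, `ν 𝓕 = 1` (★ one-shot package); right-invariant (Haar + inversion-invariant)
  obtain ⟨ν, 𝓕, hνH, hνI, h𝓕N, hν1, h𝓕c⟩ := exists_structural_datum_cm_three L
  haveI := hνH
  haveI := hνI
  haveI : ν.IsMulRightInvariant := by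
    have h := Measure.inv.instIsMulRightInvariant (μ := ν)
    rwa [Measure.inv_eq_self] at h
  have h𝓕₀ : ν 𝓕 ≠ 0 := by
    rw [hν1]
    exact one_ne_zero
  -- instance preamble for the Haar choices
  haveI := t2Space_adeleRing_of_numberField L
  haveI := locallyCompactSpace_adeleRing' L
  haveI : LocallyCompactSpace ↥(finAdelic (↥(maximalRealSubfield L)) L (IsCMField.complexConj L) 3 ((StdForm.antidiagonal 3).over L)) :=
    locallyCompactSpace_finAdelic (↥(maximalRealSubfield L)) L (IsCMField.complexConj L) 3 ((StdForm.antidiagonal 3).over L)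
  -- F5 F6: the port Haar measures
  set μa : Measure ↥(arch (↥(maximalRealSubfield L)) L (IsCMField.complexConj L) 3 ((StdForm.antidiagonal 3).over L)) := Measure.haar with hμa
  haveI : μa.IsMulRightInvariant :=
    isMulRightInvariant_of_modularCharacterFun_eq_one (modularCharacterFun_arch_eq_one L ((StdForm.antidiagonal 3).over L) (cmConj_antidiagonal_transpose L (N := 3)) (isUnit_det_antidiagonal_over L (N := 3)).ne_zero) μa
  set μf : Measure ↥(finAdelic (↥(maximalRealSubfield L)) L (IsCMField.complexConj L) 3 ((StdForm.antidiagonal 3).over L)) := Measure.haar with hμf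
  -- ED. 3 with the ★-glue rows (G), the ramification data BY NAME, the Heisenberg package and the ★ `hEXP` row
  exact resGMidBlock_eq_bot_of_not_lHalfNeZero_of_record_v3 L μ ξ μω hμu hLB (isUnitary_bcηInv_mul L ξ hμu) (bcηInv_mul_posRealIdele L ξ μω hquad)
    (S := (ξ.bcη⁻¹ * μω).ramifiedPlaces) (HeckeCharacter.finite_ramifiedPlaces_holds _) (fun w hw => not_not.1 hw)
    (T := (∅ : Set (HeightOneSpectrum (𝓞 ↥(maximalRealSubfield L))))) Set.finite_empty (fun v _ => HeckeCharacter.isUnramifiedAt_one v)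
    (bcηInv_mul_ne_one L ξ μω hquad) ν h𝓕N h𝓕c hν1 𝔓 h𝔓 hR (hEXP_tauRow_of_record L μ νG ν h𝓕N h𝓕c h𝓕₀ hβ hμZ μa μf ξ μω hμu) hSCALrows

end Summit.HodgeConjecture.HodgeConjecture.R90.S8

end
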